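import Literature.Geometry.Lorentzian.TameGenericity
import Literature.Geometry.Lorentzian.TameFamilyOffCompact
import Literature.Geometry.Lorentzian.AFEndRestrict
import HarnessLib

/-!
# Far surgery toolkit for tame witness families: the weighted distance is a pseudometric;
tameness and immersion under far surgery

The tame genericity notion of the final state conjecture (`InitialDataSet.IsTameDataFamily`,
`TameGenericity.lean`) asks a witness family `F : ℝᵐ → data` to be continuous at the base
parameter in the Dafermos–Rodnianski weighted `C² × C¹` distance `AFEnd.wDist e` of ONE fixed end
`e` (arXiv:0811.0354, App. B.2.3; the fixed function space `𝓐` of Christodoulou, CQG **16** (1999)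
A23, p. A24). TRIMMING constructions produce witness families DIAGONALLY: a far surgery
`F' c = T_{R(c)} (F c)` of vanishing weighted size `e.wDist (F' c) (F c) → 0` riding a tame family
`F` (receding Kerr-end trimming, tail cut-offs, gluing beyond radius `R(c) → ∞`). This file proves
the algebra every such construction needs:

* `enorm_iteratedFDeriv_sub_comm`, `iSup_weight_iteratedFDeriv_sub_le_add` — the calculus:
  `‖Dⁱ(f − g)‖ = ‖Dⁱ(g − f)‖` (no smoothness needed), and the weighted suprema
  `⨆_{i ≤ n, R < ‖x‖} ‖x‖^{w+i} ‖Dⁱ(f₁ − f₃)(x)‖ₑ` are subadditive in the middle function for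
  functions `C^∞` at every point of the open region `{R < ‖x‖}` (pointwise additivity of
  `iteratedFDeriv` at points of smoothness, Mathlib `iteratedFDeriv_add_apply`);
* `AFEnd.wDist_comm`, `AFEnd.wDist_triangle` — `e.wDist` is symmetric and satisfies the triangle
  inequality for ALL data sets (the chart components `hCoeff e D`, `kCoeff e D` are smooth on the
  open chart region for every `D`: `AFEnd.contDiffAt_hCoeff`, `AFEnd.ContDiffOn_kCoeff_holds`);
  with `AFEnd.wDist_self` it is an extended pseudometric on `InitialDataSet (𝓡 3) X`;
* `InitialDataSet.IsTameDataFamily.of_wDist_tendsto` — **tameness under far surgery**: `F` tame on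
  `e`, `F'` jointly smooth with `F' 0 = F 0`, DR-flat members with a continuous mass, and
  `e.wDist (F' c) (F c) → 0` as `c → 0` ⟹ `F'` tame on `e` (triangle inequality and a squeeze in
  `ℝ≥0∞`);
* `InitialDataSet.IsImmersedAtZero.congr_of_forall_eventuallyEq` — **immersion under far
  surgery**: if `F'` agrees with `F` at every point of `X` for all parameters near `0`, immersion
  at `0` passes from `F` to `F'` (the `c`-derivatives at `0` of the scalar components agree,
  `Filter.EventuallyEq.fderiv_eq`).

Everything here is proved; no definitions, no named facts. Christodoulou, CQG 16 (1999) A23,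
p. A24 (witness lines in a fixed space `𝓐`); Dafermos–Rodnianski, arXiv:0811.0354, App. B.2.3
(the weights).

Not here: the trimming / gluing constructions themselves (smooth dependence of exterior Kerr
gluing on the radius), the joint smoothness of a trimmed family, and any estimate producing
`e.wDist (F' c) (F c) → 0`.
-/

noncomputable section

open Set Function Filter Metric TopologicalSpace
open scoped Manifold ContDiff Topology ENNReal

namespace Literature.Geometry.Lorentzian

/-! ### Calculus: symmetry and subadditivity of weighted suprema of iterated derivatives -/

/-- `‖Dⁱ(f − g)(x)‖ₑ = ‖Dⁱ(g − f)(x)‖ₑ`: `f − g = −(g − f)` and `iteratedFDeriv` commutes with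
negation (no differentiability needed, Mathlib `iteratedFDeriv_neg_apply`). [folklore] -/
theorem enorm_iteratedFDeriv_sub_comm {E F : Type*} [NormedAddCommGroup E] [NormedSpace ℝ E]
    [NormedAddCommGroup F] [NormedSpace ℝ F] (f g : E → F) (i : ℕ) (x : E) :
    ‖iteratedFDeriv ℝ i (fun y ↦ f y - g y) x‖ₑ = ‖iteratedFDeriv ℝ i (fun y ↦ g y - f y) x‖ₑ := by
  have h : (fun y ↦ f y - g y) = -fun y ↦ g y - f y := funext fun y ↦ (neg_sub (g y) (f y)).symm
  rw [h, iteratedFDeriv_neg_apply, enorm_neg]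

/-- **Subadditivity of the weighted `Cⁿ` suprema.** For `f₁ f₂ f₃ : E3 → F`, each `C^∞` at every
point of the open region `{R < ‖x‖}`,
`⨆_{i ≤ n, R < ‖x‖} ‖x‖^{w+i} ‖Dⁱ(f₁ − f₃)(x)‖ₑ ≤ ⨆ … ‖Dⁱ(f₁ − f₂)‖ₑ + ⨆ … ‖Dⁱ(f₂ − f₃)‖ₑ`
in `ℝ≥0∞`: at such `x`, `Dⁱ(f₁ − f₃)(x) = Dⁱ(f₁ − f₂)(x) + Dⁱ(f₂ − f₃)(x)`
(`iteratedFDeriv_add_apply`, additivity at points of smoothness), then `enorm_add_le`.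
Dieudonné 1960, (8.12.10). [folklore] -/
theorem iSup_weight_iteratedFDeriv_sub_le_add {F : Type*} [NormedAddCommGroup F]
    [NormedSpace ℝ F] {f₁ f₂ f₃ : E3 → F} {R : ℝ}
    (h₁ : ∀ x : E3, R < ‖x‖ → ContDiffAt ℝ ∞ f₁ x) (h₂ : ∀ x : E3, R < ‖x‖ → ContDiffAt ℝ ∞ f₂ x)
    (h₃ : ∀ x : E3, R < ‖x‖ → ContDiffAt ℝ ∞ f₃ x) (n w : ℕ) :
    (⨆ (i : ℕ) (_ : i ≤ n) (x : E3) (_ : R < ‖x‖),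
        ENNReal.ofReal (‖x‖ ^ (w + i)) * ‖iteratedFDeriv ℝ i (fun y ↦ f₁ y - f₃ y) x‖ₑ) ≤
      (⨆ (i : ℕ) (_ : i ≤ n) (x : E3) (_ : R < ‖x‖),
          ENNReal.ofReal (‖x‖ ^ (w + i)) * ‖iteratedFDeriv ℝ i (fun y ↦ f₁ y - f₂ y) x‖ₑ) +
        ⨆ (i : ℕ) (_ : i ≤ n) (x : E3) (_ : R < ‖x‖),
          ENNReal.ofReal (‖x‖ ^ (w + i)) * ‖iteratedFDeriv ℝ i (fun y ↦ f₂ y - f₃ y) x‖ₑ := by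
  refine iSup₂_le fun i hi ↦ iSup₂_le fun x hx ↦ ?_
  have h₁₂ : ContDiffAt ℝ i (fun y ↦ f₁ y - f₂ y) x :=
    ((h₁ x hx).sub (h₂ x hx)).of_le (WithTop.coe_le_coe.mpr le_top)
  have h₂₃ : ContDiffAt ℝ i (fun y ↦ f₂ y - f₃ y) x :=
    ((h₂ x hx).sub (h₃ x hx)).of_le (WithTop.coe_le_coe.mpr le_top)
  have heq : (fun y ↦ f₁ y - f₃ y) = (fun y ↦ f₁ y - f₂ y) + fun y ↦ f₂ y - f₃ y :=
    funext fun y ↦ (sub_add_sub_cancel (f₁ y) (f₂ y) (f₃ y)).symm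
  -- each term is bounded by its own supremum
  have hle : ∀ g : E3 → F, ENNReal.ofReal (‖x‖ ^ (w + i)) * ‖iteratedFDeriv ℝ i g x‖ₑ ≤
      ⨆ (i : ℕ) (_ : i ≤ n) (x : E3) (_ : R < ‖x‖),
        ENNReal.ofReal (‖x‖ ^ (w + i)) * ‖iteratedFDeriv ℝ i g x‖ₑ :=
    fun g ↦ le_iSup₂_of_le i hi <| le_iSup₂_of_le (f := fun (x : E3) (_ : R < ‖x‖) ↦
      ENNReal.ofReal (‖x‖ ^ (w + i)) * ‖iteratedFDeriv ℝ i g x‖ₑ) x hx le_rfl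
  rw [heq, iteratedFDeriv_add_apply h₁₂ h₂₃]
  calc ENNReal.ofReal (‖x‖ ^ (w + i)) *
        ‖iteratedFDeriv ℝ i (fun y ↦ f₁ y - f₂ y) x + iteratedFDeriv ℝ i (fun y ↦ f₂ y - f₃ y) x‖ₑ
      ≤ ENNReal.ofReal (‖x‖ ^ (w + i)) *
          (‖iteratedFDeriv ℝ i (fun y ↦ f₁ y - f₂ y) x‖ₑ +
            ‖iteratedFDeriv ℝ i (fun y ↦ f₂ y - f₃ y) x‖ₑ) := by
        gcongr
        exact enorm_add_le _ _
    _ = ENNReal.ofReal (‖x‖ ^ (w + i)) * ‖iteratedFDeriv ℝ i (fun y ↦ f₁ y - f₂ y) x‖ₑ +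
          ENNReal.ofReal (‖x‖ ^ (w + i)) * ‖iteratedFDeriv ℝ i (fun y ↦ f₂ y - f₃ y) x‖ₑ :=
        mul_add _ _ _
    _ ≤ _ := add_le_add (hle fun y ↦ f₁ y - f₂ y) (hle fun y ↦ f₂ y - f₃ y)

/-! ### The weighted distance is an extended pseudometric -/

namespace AFEnd

variable {X : Type*} [TopologicalSpace X] [ChartedSpace E3 X] [IsManifold (𝓡 3) ∞ X]

/-- **The weighted distance is symmetric**: `e.wDist D D' = e.wDist D' D` (the integrands are
norms of iterated derivatives of `h − h'`, `k − k'`, invariant under `f − g ↦ g − f`). [folklore] -/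
theorem wDist_comm (e : AFEnd X) (D D' : InitialDataSet (𝓡 3) X) : e.wDist D D' = e.wDist D' D := by
  simp only [wDist, enorm_iteratedFDeriv_sub_comm (hCoeff e D) (hCoeff e D'),
    enorm_iteratedFDeriv_sub_comm (kCoeff e D) (kCoeff e D')]

/-- The chart components of `k` are smooth at every point of the open exterior region
(pointwise form of `AFEnd.ContDiffOn_kCoeff_holds`).
[cite: ChristodoulouKlainerman1993, §1, (1.0.9b)] -/
theorem contDiffAt_kCoeff (e : AFEnd X) (D : InitialDataSet (𝓡 3) X) {x : E3} (hx : e.R < ‖x‖) :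
    ContDiffAt ℝ ∞ (kCoeff e D) x :=
  (ContDiffOn_kCoeff_holds e D).contDiffAt
    ((isOpen_lt continuous_const continuous_norm).mem_nhds hx)

/-- **Triangle inequality for the weighted distance**:
`e.wDist D₁ D₃ ≤ e.wDist D₁ D₂ + e.wDist D₂ D₃` for ALL data sets `D₁ D₂ D₃` on `X` (in `ℝ≥0∞`).
The chart components `hCoeff e Dᵢ`, `kCoeff e Dᵢ` are `C^∞` on the open chart region
`{e.R < ‖x‖}` over which the suprema run (`contDiffAt_hCoeff`, `contDiffAt_kCoeff`), so the
iterated derivatives of the differences are additive there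
(`iSup_weight_iteratedFDeriv_sub_le_add`); then regroup the four suprema. With
`wDist_self` and `wDist_comm`, `e.wDist` is an extended pseudometric — the uniform structure of
Christodoulou's fixed space `𝓐` read on the end `e`. [folklore] -/
theorem wDist_triangle (e : AFEnd X) (D₁ D₂ D₃ : InitialDataSet (𝓡 3) X) :
    e.wDist D₁ D₃ ≤ e.wDist D₁ D₂ + e.wDist D₂ D₃ := by
  have hh := iSup_weight_iteratedFDeriv_sub_le_add
    (fun x hx ↦ e.contDiffAt_hCoeff D₁ hx) (fun x hx ↦ e.contDiffAt_hCoeff D₂ hx)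
    (fun x hx ↦ e.contDiffAt_hCoeff D₃ hx) 2 1
  have hk := iSup_weight_iteratedFDeriv_sub_le_add
    (fun x hx ↦ e.contDiffAt_kCoeff D₁ hx) (fun x hx ↦ e.contDiffAt_kCoeff D₂ hx)
    (fun x hx ↦ e.contDiffAt_kCoeff D₃ hx) 1 2
  calc e.wDist D₁ D₃ ≤ _ := add_le_add hh hk
    _ = e.wDist D₁ D₂ + e.wDist D₂ D₃ := by
      unfold wDist
      exact add_add_add_comm _ _ _ _

/-- Continuity of `wDist` to a fixed datum passes along far surgeries of vanishing size: if
`e.wDist (F' c) (F c) → 0` and `e.wDist (F c) D → 0` along a filter `l`, then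
`e.wDist (F' c) D → 0` along `l` (triangle inequality and a squeeze in `ℝ≥0∞`). [folklore] -/
theorem tendsto_wDist_of_tendsto_wDist {ι : Type*} {l : Filter ι} (e : AFEnd X)
    {F F' : ι → InitialDataSet (𝓡 3) X} {D : InitialDataSet (𝓡 3) X}
    (hFF' : Tendsto (fun c ↦ e.wDist (F' c) (F c)) l (𝓝 0))
    (hF : Tendsto (fun c ↦ e.wDist (F c) D) l (𝓝 0)) :
    Tendsto (fun c ↦ e.wDist (F' c) D) l (𝓝 0) := by
  have hsum : Tendsto (fun c ↦ e.wDist (F' c) (F c) + e.wDist (F c) D) l (𝓝 0) := by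
    simpa using hFF'.add hF
  exact tendsto_of_tendsto_of_tendsto_of_le_of_le tendsto_const_nhds hsum (fun _ ↦ zero_le)
    fun c ↦ e.wDist_triangle (F' c) (F c) D

end AFEnd

/-! ### Tameness and immersion under far surgery -/

namespace InitialDataSet

section Immersion

variable {E : Type*} [NormedAddCommGroup E] [NormedSpace ℝ E] {H : Type*} [TopologicalSpace H]
  {I : ModelWithCorners ℝ E H} {X : Type*} [TopologicalSpace X] [ChartedSpace H X]
  [IsManifold I ∞ X]

-- adapted from Summits/FinalStateConjecture/FinalStateConjecture/Cruxes/ModulatedKerrHandoff/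
-- SketchIdeator1r1.lean (crux-ideate round 1), generalised to an arbitrary model `I`.
/-- **Far surgery riding an immersed family keeps it immersed** (the diagonal family): if `F'`
agrees with `F` at every point of `X` for all parameters `c` near `0` — how near may depend on the
point, e.g. `F' c` is `F c` modified only beyond coordinate radius `R(c) → ∞` — then immersion at
`0` (`IsImmersedAtZero`) passes from `F` to `F'`: the scalar components `c ↦ h_c(x)(u, w)`,
`c ↦ k_c(x)(u, w)` of the two families agree near `c = 0`, so their derivatives at `0` agree
(`Filter.EventuallyEq.fderiv_eq`). [folklore] -/
theorem IsImmersedAtZero.congr_of_forall_eventuallyEq {m : ℕ}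
    {F F' : EuclideanSpace ℝ (Fin m) → InitialDataSet I X} (himm : IsImmersedAtZero m F)
    (hFF' : ∀ x : X, ∀ᶠ c in 𝓝 (0 : EuclideanSpace ℝ (Fin m)),
      (F' c).h.inner x = (F c).h.inner x ∧ (F' c).k x = (F c).k x) :
    IsImmersedAtZero m F' := by
  intro v hv
  obtain ⟨x, u, w, huw⟩ := himm v hv
  refine ⟨x, u, w, ?_⟩
  have h₁ : (fun c ↦ (F' c).h.inner x u w) =ᶠ[𝓝 0] fun c ↦ (F c).h.inner x u w :=
    (hFF' x).mono fun c hc ↦ by simp only [hc.1]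
  have h₂ : (fun c ↦ (F' c).k x u w) =ᶠ[𝓝 0] fun c ↦ (F c).k x u w :=
    (hFF' x).mono fun c hc ↦ by simp only [hc.2]
  rw [h₁.fderiv_eq, h₂.fderiv_eq]
  exact huw

end Immersion

variable {X : Type*} [TopologicalSpace X] [ChartedSpace E3 X] [IsManifold (𝓡 3) ∞ X]

/-- **Tameness under far surgery** (the diagonal trimming family is tame). Let `F` be tame on the
end `e` (`IsTameDataFamily`), and let `F'` be a jointly smooth family (`IsSmoothDataFamily`) with
the same base member `F' 0 = F 0`, all of whose members are Dafermos–Rodnianski flat on `e` with a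
continuous mass function `M'`, and whose weighted distance to the corresponding members of `F`
vanishes at the base parameter, `e.wDist (F' c) (F c) → 0` as `c → 0` (a far surgery of vanishing
weighted size, e.g. trimming `F c` to exact Kerr/harmonic asymptotics beyond radius `R(c) → ∞`).
Then `F'` is tame on `e`: joint smoothness, soleness of `e` and the decay are the hypotheses, and
`e.wDist (F' c) (F' 0) = e.wDist (F' c) (F 0) ≤ e.wDist (F' c) (F c) + e.wDist (F c) (F 0) → 0`
(`AFEnd.wDist_triangle`). This is the stability of membership in Christodoulou's fixed space `𝓐`
of data with fixed asymptotics (CQG 16 (1999) A23, p. A24) under perturbations small in its own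
norm, for the Dafermos–Rodnianski weights (arXiv:0811.0354, App. B.2.3).
[cite: Christodoulou1999, p. A24] -/
theorem IsTameDataFamily.of_wDist_tendsto {e : AFEnd X} {m : ℕ}
    {F F' : EuclideanSpace ℝ (Fin m) → InitialDataSet (𝓡 3) X}
    {M' : EuclideanSpace ℝ (Fin m) → ℝ} (hF : IsTameDataFamily e m F)
    (hF' : IsSmoothDataFamily m F') (h0 : F' 0 = F 0) (hM' : Continuous M')
    (hDR : ∀ c, e.IsStronglyAsymptoticallyFlatDR (F' c) (M' c))
    (hw : Tendsto (fun c ↦ e.wDist (F' c) (F c)) (𝓝 0) (𝓝 0)) :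
    IsTameDataFamily e m F' := by
  refine ⟨hF', hF.2.1, ⟨M', hM', hDR⟩, ?_⟩
  rw [h0]
  exact e.tendsto_wDist_of_tendsto_wDist hw hF.2.2.2

/-- **The diagonal far-surgery family is a tame immersed family** (both transfers at once): under
the hypotheses of `IsTameDataFamily.of_wDist_tendsto`, if moreover `F` is immersed at `0` and `F'`
agrees with `F` at every point for all parameters near `0`, then `F'` is tame on `e` AND immersed
at `0` — the form in which trimming constructions feed `HasTameCodimAtLeastIn`.
[cite: Christodoulou1999, p. A24] -/
theorem IsTameDataFamily.of_wDist_tendsto_of_forall_eventuallyEq {e : AFEnd X} {m : ℕ}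
    {F F' : EuclideanSpace ℝ (Fin m) → InitialDataSet (𝓡 3) X}
    {M' : EuclideanSpace ℝ (Fin m) → ℝ} (hF : IsTameDataFamily e m F) (himm : IsImmersedAtZero m F)
    (hF' : IsSmoothDataFamily m F') (h0 : F' 0 = F 0) (hM' : Continuous M')
    (hDR : ∀ c, e.IsStronglyAsymptoticallyFlatDR (F' c) (M' c))
    (hw : Tendsto (fun c ↦ e.wDist (F' c) (F c)) (𝓝 0) (𝓝 0))
    (hFF' : ∀ x : X, ∀ᶠ c in 𝓝 (0 : EuclideanSpace ℝ (Fin m)),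
      (F' c).h.inner x = (F c).h.inner x ∧ (F' c).k x = (F c).k x) :
    IsTameDataFamily e m F' ∧ IsImmersedAtZero m F' :=
  ⟨hF.of_wDist_tendsto hF' h0 hM' hDR hw, himm.congr_of_forall_eventuallyEq hFF'⟩

end InitialDataSet

end Literature.Geometry.Lorentzian

end
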